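import Literature.Probability.LatticeModels.StarBoundary
import HarnessLib

/-!
# `★`-components of the complement of a finite set: exterior, hull and interior components

Topic `Literature/Probability/LatticeModels`. For a finite set `S ⊂ ℤ^d` (`d ≥ 2`) the complement
`Sᶜ` splits into `★`-components (classes of the chain relation `starRel Sᶜ`); exactly one of them
is unbounded — the **exterior** `starExt S`, the class of the far region
`{x : ‖x‖_∞ > R} ⊇ (box R)ᶜ`, which is `★`-connected for `d ≥ 2` — and the others, the
**interior components** `starIntComp S x`, lie in the bounding box of `S`; `starHull S = (starExt S)ᶜ`
is `S` with its holes filled (Friedli–Velenik 2017, §7.2.6, eq. (7.22): `γ̄ᶜ = {A₀, A₁, …, A_k}`,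
`A₀ = ext γ` the unique unbounded component). We also record the connectivity facts used with
Lemma B.82: if `S` is `★`-connected then the hull and the complement of every interior component
are `★`-connected (Friedli–Velenik, Exercise 7.11), and every `★`-component of `Sᶜ` is
`★`-adjacent to `S`.

Everything is proved; no named facts.

## References

* S. Friedli, Y. Velenik, *Statistical Mechanics of Lattice Systems*, CUP 2017, §7.2.6
  (eq. (7.22), Exercise 7.11, Lemma 7.19) and App. B.15. [FriedliVelenik2017]
-/

noncomputable section

open Finset SimpleGraph Relation

namespace Literature.Probability.LatticeModels

variable {d : ℕ}

/-! ### Moving along coordinate lines -/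

/-- Consecutive points of a coordinate line are `★`-adjacent. [folklore] -/
theorem adj_update_succ (x : Site d) (k : Fin d) (w : ℤ) :
    (zdStar d).Adj (Function.update x k w) (Function.update x k (w + 1)) := by
  refine zdStar_adj_of_forall (fun h => ?_) (fun j => ?_)
  · have := congrFun h k
    simp only [Function.update_self] at this
    omega
  · by_cases hj : j = k
    · subst hj; simp
    · simp [Function.update_of_ne hj]

/-- Moving coordinate `k` up by `n` unit steps inside `T`. [folklore] -/
theorem reflTransGen_update_add {T : Set (Site d)} (x : Site d) (k : Fin d) (n : ℕ)
    (h : ∀ m : ℕ, m ≤ n → Function.update x k (x k + m) ∈ T) :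
    ReflTransGen (starRel T) x (Function.update x k (x k + n)) := by
  induction n with
  | zero =>
    simp only [Nat.cast_zero, add_zero, Function.update_eq_self]
    exact ReflTransGen.refl
  | succ n ih =>
    refine (ih fun m hm => h m (by omega)).tail ⟨?_, h n (by omega), h (n + 1) le_rfl⟩
    rw [Nat.cast_succ, ← add_assoc]
    exact adj_update_succ x k (x k + n)

/-- Moving coordinate `k` down by `n` unit steps inside `T`. [folklore] -/
theorem reflTransGen_update_sub {T : Set (Site d)} (x : Site d) (k : Fin d) (n : ℕ)
    (h : ∀ m : ℕ, m ≤ n → Function.update x k (x k - m) ∈ T) :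
    ReflTransGen (starRel T) x (Function.update x k (x k - n)) := by
  induction n with
  | zero =>
    simp only [Nat.cast_zero, sub_zero, Function.update_eq_self]
    exact ReflTransGen.refl
  | succ n ih =>
    refine (ih fun m hm => h m (by omega)).tail ⟨?_, h n (by omega), h (n + 1) le_rfl⟩
    have := (adj_update_succ x k (x k - (n + 1))).symm
    rw [show x k - ((n : ℤ) + 1) + 1 = x k - n by ring] at this
    rw [Nat.cast_succ]
    exact this

/-- Moving coordinate `k` to any value, when every point of the line through `x` in direction `k`
lies in `T`. [folklore] -/
theorem reflTransGen_update_of_forall {T : Set (Site d)} (x : Site d) (k : Fin d) (v : ℤ)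
    (h : ∀ w : ℤ, Function.update x k w ∈ T) : ReflTransGen (starRel T) x (Function.update x k v) := by
  rcases le_or_gt (x k) v with hle | hlt
  · obtain ⟨n, hn⟩ := Int.le.dest hle
    rw [← hn]
    exact reflTransGen_update_add x k n fun m _ => h _
  · obtain ⟨n, hn⟩ := Int.le.dest hlt.le
    rw [show v = x k - n by omega]
    exact reflTransGen_update_sub x k n fun m _ => h _

/-- Moving all coordinates: `ℤ^{d★}` is `★`-connected. [cite: FriedliVelenik2017, App. B.15] -/
theorem reflTransGen_starRel_univ (x y : Site d) : ReflTransGen (starRel Set.univ) x y := by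
  suffices key : ∀ (n : ℕ) (z : Site d), #(univ.filter fun k => z k ≠ y k) ≤ n →
      ReflTransGen (starRel Set.univ) z y from key d x ((card_filter_le _ _).trans (by simp))
  intro n
  induction n with
  | zero =>
    intro z hn
    have : z = y := funext fun k => by
      by_contra hk
      have : 0 < #(univ.filter fun k => z k ≠ y k) := card_pos.2 ⟨k, mem_filter.2 ⟨mem_univ k, hk⟩⟩
      omega
    subst this
    exact ReflTransGen.refl
  | succ n ih =>
    intro z hn
    by_cases hall : ∀ k, z k = y k
    · rw [show z = y from funext hall]
    · push Not at hall
      obtain ⟨k, hk⟩ := hall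
      refine (reflTransGen_update_of_forall z k (y k) fun _ => Set.mem_univ _).trans (ih _ ?_)
      have hset : (univ.filter fun k' => Function.update z k (y k) k' ≠ y k') =
          (univ.filter fun k' => z k' ≠ y k').erase k := by
        ext k'
        simp only [mem_filter, mem_univ, true_and, mem_erase]
        by_cases hk' : k' = k
        · subst hk'; simp
        · rw [Function.update_of_ne hk']; tauto
      rw [hset, card_erase_of_mem (mem_filter.2 ⟨mem_univ k, hk⟩)]
      omega

/-! ### The far region -/

/-- The far region `{x : ‖x‖_∞ > R}`: points with a coordinate of absolute value `> R`, i.e. the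
complement of the box `{-R,…,R}^d`. [cite: FriedliVelenik2017, §7.2.6 (the unbounded component)] -/
def farSet (d R : ℕ) : Set (Site d) := {x | ∃ i, R < (x i).natAbs}

/-- The far region is the complement of the box. [folklore] -/
theorem mem_farSet_iff_not_mem_box {R : ℕ} {x : Site d} : x ∈ farSet d R ↔ x ∉ box d R := by
  rw [mem_box, not_forall]
  simp only [farSet, Set.mem_setOf_eq]
  constructor
  · rintro ⟨i, hi⟩; exact ⟨i, by omega⟩
  · rintro ⟨i, hi⟩; exact ⟨i, by omega⟩

/-- For `d ≥ 2`, every far point is chained inside the far region to the corner `(R+1,…,R+1)`: pin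
a second coordinate at `R+1`, then bring every other coordinate to `R+1`.
[cite: FriedliVelenik2017, §7.2.6 (uniqueness of the unbounded component)] -/
theorem reflTransGen_farSet_corner (hd : 2 ≤ d) {R : ℕ} {x : Site d} (hx : x ∈ farSet d R) :
    ReflTransGen (starRel (farSet d R)) x (fun _ => (R : ℤ) + 1) := by
  obtain ⟨i, hi⟩ := hx
  set L : ℤ := R + 1 with hL
  have hLfar : R < L.natAbs := by rw [hL]; omega
  obtain ⟨j, hji⟩ : ∃ j : Fin d, j ≠ i := by
    have : Nontrivial (Fin d) := Fin.nontrivial_iff_two_le.2 hd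
    exact exists_ne i
  -- pin coordinate `j` at `L`; coordinate `i` keeps the line far
  have h1 : ReflTransGen (starRel (farSet d R)) x (Function.update x j L) :=
    reflTransGen_update_of_forall x j L fun w => ⟨i, by rw [Function.update_of_ne hji.symm]; exact hi⟩
  -- with `j` pinned, bring all other coordinates to `L`
  have key : ∀ (n : ℕ) (y : Site d), y j = L → #(univ.filter fun k => y k ≠ L) ≤ n →
      ReflTransGen (starRel (farSet d R)) y (fun _ => L) := by
    intro n
    induction n with
    | zero =>
      intro y hyj hn
      have : y = fun _ => L := funext fun k => by
        by_contra hk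
        have : 0 < #(univ.filter fun k => y k ≠ L) := card_pos.2 ⟨k, mem_filter.2 ⟨mem_univ k, hk⟩⟩
        omega
      subst this
      exact ReflTransGen.refl
    | succ n ih =>
      intro y hyj hn
      by_cases hall : ∀ k, y k = L
      · have : y = fun _ => L := funext hall
        subst this
        exact ReflTransGen.refl
      · push Not at hall
        obtain ⟨k, hk⟩ := hall
        have hkj : k ≠ j := fun h => hk (h ▸ hyj)
        have hstep : ReflTransGen (starRel (farSet d R)) y (Function.update y k L) :=
          reflTransGen_update_of_forall y k L fun w => ⟨j, by rw [Function.update_of_ne hkj.symm, hyj]; exact hLfar⟩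
        refine hstep.trans (ih _ (by rw [Function.update_of_ne hkj.symm]; exact hyj) ?_)
        have hset : (univ.filter fun k' => Function.update y k L k' ≠ L) =
            (univ.filter fun k' => y k' ≠ L).erase k := by
          ext k'
          simp only [mem_filter, mem_univ, true_and, mem_erase]
          by_cases hk' : k' = k
          · subst hk'; simp
          · rw [Function.update_of_ne hk']; tauto
        rw [hset, card_erase_of_mem (mem_filter.2 ⟨mem_univ k, hk⟩)]
        omega
  exact h1.trans (key d _ (by simp) ((card_filter_le _ _).trans (by simp)))

/-- **The far region is `★`-connected** for `d ≥ 2`. [cite: FriedliVelenik2017, §7.2.6] -/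
theorem starConn_farSet (hd : 2 ≤ d) (R : ℕ) : StarConn (farSet d R) := fun _ hx _ hy =>
  (reflTransGen_farSet_corner hd hx).trans (reflTransGen_starRel_symm (reflTransGen_farSet_corner hd hy))

/-- The far region grows as the radius shrinks. [folklore] -/
theorem farSet_mono {R R' : ℕ} (h : R ≤ R') : farSet d R' ⊆ farSet d R :=
  fun _ ⟨i, hi⟩ => ⟨i, lt_of_le_of_lt h hi⟩

/-- The corner `(R'+1, …, R'+1)` is far (for `d ≥ 1`). [folklore] -/
theorem corner_mem_farSet (hd : 1 ≤ d) {R R' : ℕ} (h : R ≤ R') : (fun _ => (R' : ℤ) + 1) ∈ farSet d R :=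
  ⟨⟨0, hd⟩, by simp only; omega⟩

/-! ### Exterior, hull and interior components of the complement of a finite set -/

/-- The sup-norm radius of a finite set: `S ⊆ box (boxRadius S)`. [folklore] -/
def boxRadius (S : Finset (Site d)) : ℕ := S.sup fun x => univ.sup fun i => (x i).natAbs

/-- `S` lies in the box of radius `boxRadius S`. [folklore] -/
theorem subset_box_boxRadius (S : Finset (Site d)) : S ⊆ box d (boxRadius S) := by
  intro x hx
  rw [mem_box]
  intro i
  have h1 : (x i).natAbs ≤ univ.sup fun i => (x i).natAbs := le_sup (f := fun i => (x i).natAbs) (mem_univ i)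
  have h2 : (univ.sup fun i => (x i).natAbs) ≤ boxRadius S := le_sup (f := fun x => univ.sup fun i => (x i).natAbs) hx
  omega

/-- The far region of a box containing `S` misses `S`. [folklore] -/
theorem farSet_subset_compl {S : Finset (Site d)} {R : ℕ} (hS : S ⊆ box d R) : farSet d R ⊆ (S : Set (Site d))ᶜ :=
  fun _ hx hxS => (mem_farSet_iff_not_mem_box.1 hx) (hS (mem_coe.1 hxS))

/-- From a far point at one admissible radius to a far point at another, inside `Sᶜ`. [folklore] -/
theorem exists_far_reflTransGen (hd : 2 ≤ d) {S : Finset (Site d)} {R₁ : ℕ} (hS : S ⊆ box d R₁) (R₂ : ℕ)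
    {y₁ : Site d} (hy₁ : y₁ ∈ farSet d R₁) :
    ∃ y₂ ∈ farSet d R₂, ReflTransGen (starRel (S : Set (Site d))ᶜ) y₁ y₂ := by
  refine ⟨fun _ => ((max R₁ R₂ : ℕ) : ℤ) + 1, corner_mem_farSet (by omega) (le_max_right _ _), ?_⟩
  exact reflTransGen_starRel_mono (farSet_subset_compl hS)
    (starConn_farSet hd R₁ _ hy₁ _ (corner_mem_farSet (by omega) (le_max_left _ _)))

/-- **The exterior** of a finite set `S` (`d ≥ 2`): the points of `Sᶜ` chained inside `Sᶜ` to the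
far region — the unique unbounded `★`-component `A₀ = ext` of `Sᶜ`.
[cite: FriedliVelenik2017, §7.2.6, eq. (7.22) (the exterior ext γ)] -/
def starExt (S : Finset (Site d)) : Set (Site d) :=
  {x | x ∉ S ∧ ∃ y ∈ farSet d (boxRadius S), ReflTransGen (starRel (S : Set (Site d))ᶜ) x y}

/-- The exterior in terms of any box containing `S`. [cite: FriedliVelenik2017, §7.2.6] -/
theorem mem_starExt_iff (hd : 2 ≤ d) {S : Finset (Site d)} {R : ℕ} (hS : S ⊆ box d R) {x : Site d} :
    x ∈ starExt S ↔ x ∉ S ∧ ∃ y ∈ farSet d R, ReflTransGen (starRel (S : Set (Site d))ᶜ) x y := by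
  constructor
  · rintro ⟨hx, y, hy, hxy⟩
    obtain ⟨y₂, hy₂, h⟩ := exists_far_reflTransGen hd (subset_box_boxRadius S) R hy
    exact ⟨hx, y₂, hy₂, hxy.trans h⟩
  · rintro ⟨hx, y, hy, hxy⟩
    obtain ⟨y₂, hy₂, h⟩ := exists_far_reflTransGen hd hS (boxRadius S) hy
    exact ⟨hx, y₂, hy₂, hxy.trans h⟩

/-- The exterior misses `S`. [folklore] -/
theorem not_mem_of_mem_starExt {S : Finset (Site d)} {x : Site d} (hx : x ∈ starExt S) : x ∉ S := hx.1

/-- Far points are exterior. [cite: FriedliVelenik2017, §7.2.6] -/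
theorem farSet_subset_starExt (hd : 2 ≤ d) {S : Finset (Site d)} {R : ℕ} (hS : S ⊆ box d R) :
    farSet d R ⊆ starExt S := fun x hx =>
  (mem_starExt_iff hd hS).2 ⟨fun h => (mem_farSet_iff_not_mem_box.1 hx) (hS h), x, hx, ReflTransGen.refl⟩

/-- Points outside a box containing `S` are exterior. [cite: FriedliVelenik2017, §7.2.6] -/
theorem mem_starExt_of_not_mem_box (hd : 2 ≤ d) {S : Finset (Site d)} {R : ℕ} (hS : S ⊆ box d R) {x : Site d}
    (hx : x ∉ box d R) : x ∈ starExt S :=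
  farSet_subset_starExt hd hS (mem_farSet_iff_not_mem_box.2 hx)

/-- The exterior is closed under `★`-steps in `Sᶜ`. [folklore] -/
theorem mem_starExt_of_reflTransGen {S : Finset (Site d)} {x x' : Site d} (hx : x ∈ starExt S)
    (h : ReflTransGen (starRel (S : Set (Site d))ᶜ) x x') : x' ∈ starExt S := by
  obtain ⟨hxS, y, hy, hxy⟩ := hx
  have hx'S : x' ∈ (S : Set (Site d))ᶜ := mem_of_reflTransGen_starRel h hxS
  exact ⟨hx'S, y, hy, (reflTransGen_starRel_symm h).trans hxy⟩

/-- **The exterior is `★`-connected** (`d ≥ 2`). [cite: FriedliVelenik2017, §7.2.6 and Lemma 7.19] -/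
theorem starConn_starExt (hd : 2 ≤ d) (S : Finset (Site d)) : StarConn (starExt S) := by
  intro x hx x' hx'
  obtain ⟨-, y, hy, hxy⟩ := id hx
  obtain ⟨-, y', hy', hxy'⟩ := id hx'
  have hyy' : ReflTransGen (starRel (S : Set (Site d))ᶜ) y y' :=
    reflTransGen_starRel_mono (farSet_subset_compl (subset_box_boxRadius S)) (starConn_farSet hd _ _ hy _ hy')
  have h : ReflTransGen (starRel (S : Set (Site d))ᶜ) x x' := (hxy.trans hyy').trans (reflTransGen_starRel_symm hxy')
  exact reflTransGen_starRel_restrict (fun a ha b hab => mem_starExt_of_reflTransGen ha (ReflTransGen.single hab)) hx h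

/-- **The hull** of a finite set: the complement of its exterior (`S` with its holes filled).
[cite: FriedliVelenik2017, §7.2.6 (γ̄ ∪ int γ)] -/
def starHull (S : Finset (Site d)) : Set (Site d) := (starExt S)ᶜ

/-- `S` lies in its hull. [folklore] -/
theorem subset_starHull (S : Finset (Site d)) : (S : Set (Site d)) ⊆ starHull S :=
  fun _ hx hext => hext.1 hx

/-- The hull lies in any box containing `S`. [cite: FriedliVelenik2017, §7.2.6] -/
theorem starHull_subset_box (hd : 2 ≤ d) {S : Finset (Site d)} {R : ℕ} (hS : S ⊆ box d R) :
    starHull S ⊆ (box d R : Set (Site d)) := fun _ hx => by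
  by_contra h
  exact hx (mem_starExt_of_not_mem_box hd hS h)

open Classical in
/-- The hull as a finset. [cite: FriedliVelenik2017, §7.2.6] -/
def starHullFinset (S : Finset (Site d)) : Finset (Site d) := (box d (boxRadius S)).filter (· ∈ starHull S)

/-- Membership in the hull finset. [folklore] -/
theorem mem_starHullFinset (hd : 2 ≤ d) {S : Finset (Site d)} {x : Site d} : x ∈ starHullFinset S ↔ x ∈ starHull S := by
  classical
  rw [starHullFinset, mem_filter]
  exact ⟨fun h => h.2, fun h => ⟨starHull_subset_box hd (subset_box_boxRadius S) h, h⟩⟩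

/-- The hull finset is the hull. [folklore] -/
theorem coe_starHullFinset (hd : 2 ≤ d) (S : Finset (Site d)) : (starHullFinset S : Set (Site d)) = starHull S :=
  Set.ext fun _ => by rw [mem_coe, mem_starHullFinset hd]

/-- **The interior** of a finite set: the points of the hull outside `S` (the union of the bounded
`★`-components of `Sᶜ`). [cite: FriedliVelenik2017, §7.2.6 (int γ)] -/
def starInt (S : Finset (Site d)) : Finset (Site d) := starHullFinset S \ S

/-- Membership in the interior. [cite: FriedliVelenik2017, §7.2.6] -/
theorem mem_starInt (hd : 2 ≤ d) {S : Finset (Site d)} {x : Site d} : x ∈ starInt S ↔ x ∉ S ∧ x ∉ starExt S := by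
  rw [starInt, mem_sdiff, mem_starHullFinset hd, starHull, Set.mem_compl_iff]; tauto

/-- The interior lies in any box containing `S`. [cite: FriedliVelenik2017, §7.2.6] -/
theorem starInt_subset_box (hd : 2 ≤ d) {S : Finset (Site d)} {R : ℕ} (hS : S ⊆ box d R) : starInt S ⊆ box d R :=
  fun _ hx => mem_coe.1 (starHull_subset_box hd hS ((mem_starInt hd).1 hx).2)

/-- The interior is closed under `★`-steps in `Sᶜ`. [folklore] -/
theorem mem_starInt_of_reflTransGen (hd : 2 ≤ d) {S : Finset (Site d)} {x x' : Site d} (hx : x ∈ starInt S)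
    (h : ReflTransGen (starRel (S : Set (Site d))ᶜ) x x') : x' ∈ starInt S := by
  rw [mem_starInt hd] at hx ⊢
  exact ⟨mem_of_reflTransGen_starRel h hx.1, fun hext =>
    hx.2 (mem_starExt_of_reflTransGen hext (reflTransGen_starRel_symm h))⟩

open Classical in
/-- **The interior component** of `Sᶜ` through `x`: the points chained to `x` inside `Sᶜ`
(meaningful for `x ∈ starInt S`; these are the bounded components `A₁, …, A_k` of eq. (7.22)).
[cite: FriedliVelenik2017, §7.2.6, eq. (7.22)] -/
def starIntComp (S : Finset (Site d)) (x : Site d) : Finset (Site d) :=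
  (starInt S).filter fun y => ReflTransGen (starRel (S : Set (Site d))ᶜ) x y

/-- Membership in an interior component. [cite: FriedliVelenik2017, §7.2.6] -/
theorem mem_starIntComp (hd : 2 ≤ d) {S : Finset (Site d)} {x : Site d} (hx : x ∈ starInt S) {y : Site d} :
    y ∈ starIntComp S x ↔ ReflTransGen (starRel (S : Set (Site d))ᶜ) x y := by
  classical
  rw [starIntComp, mem_filter]
  exact ⟨fun h => h.2, fun h => ⟨mem_starInt_of_reflTransGen hd hx h, h⟩⟩

/-- An interior component lies in the interior. [folklore] -/
theorem starIntComp_subset (S : Finset (Site d)) (x : Site d) : starIntComp S x ⊆ starInt S := by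
  classical
  exact filter_subset _ _

/-- The base point belongs to its component. [folklore] -/
theorem mem_starIntComp_self (hd : 2 ≤ d) {S : Finset (Site d)} {x : Site d} (hx : x ∈ starInt S) :
    x ∈ starIntComp S x := (mem_starIntComp hd hx).2 ReflTransGen.refl

/-- Interior components are closed under `★`-steps in `Sᶜ` (maximality). [cite: FriedliVelenik2017, §7.2.6] -/
theorem mem_starIntComp_of_starRel (hd : 2 ≤ d) {S : Finset (Site d)} {x : Site d} (hx : x ∈ starInt S)
    {a b : Site d} (ha : a ∈ starIntComp S x) (hab : starRel (S : Set (Site d))ᶜ a b) : b ∈ starIntComp S x :=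
  (mem_starIntComp hd hx).2 (((mem_starIntComp hd hx).1 ha).tail hab)

/-- **Interior components are `★`-connected.** [cite: FriedliVelenik2017, §7.2.6] -/
theorem starConn_starIntComp (hd : 2 ≤ d) {S : Finset (Site d)} {x : Site d} (hx : x ∈ starInt S) :
    StarConn (starIntComp S x : Set (Site d)) := by
  intro a ha b hb
  have hab : ReflTransGen (starRel (S : Set (Site d))ᶜ) a b :=
    (reflTransGen_starRel_symm ((mem_starIntComp hd hx).1 (mem_coe.1 ha))).trans ((mem_starIntComp hd hx).1 (mem_coe.1 hb))
  exact reflTransGen_starRel_restrict (fun a ha b hab => mem_coe.2 (mem_starIntComp_of_starRel hd hx (mem_coe.1 ha) hab)) ha hab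

/-- Components through chained points coincide. [folklore] -/
theorem starIntComp_eq_of_mem (hd : 2 ≤ d) {S : Finset (Site d)} {x y : Site d} (hx : x ∈ starInt S)
    (hy : y ∈ starIntComp S x) : starIntComp S y = starIntComp S x := by
  have hy' : y ∈ starInt S := starIntComp_subset S x hy
  have hxy := (mem_starIntComp hd hx).1 hy
  ext z
  rw [mem_starIntComp hd hy', mem_starIntComp hd hx]
  exact ⟨fun h => hxy.trans h, fun h => (reflTransGen_starRel_symm hxy).trans h⟩

/-- **The decomposition `Sᶜ = ext ⊔ ⋃ int-components`**: a point off `S` is exterior or interior.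
[cite: FriedliVelenik2017, §7.2.6, eq. (7.22)] -/
theorem mem_starExt_or_mem_starInt (hd : 2 ≤ d) {S : Finset (Site d)} {x : Site d} (hx : x ∉ S) :
    x ∈ starExt S ∨ x ∈ starInt S := by
  by_cases h : x ∈ starExt S
  · exact Or.inl h
  · exact Or.inr ((mem_starInt hd).2 ⟨hx, h⟩)

/-- A `★`-connected set avoiding `S` that meets the exterior lies in the exterior. [folklore] -/
theorem subset_starExt_of_starConn {S : Finset (Site d)} {C : Set (Site d)} (hC : StarConn C)
    (hCS : Disjoint C (S : Set (Site d))) {x : Site d} (hx : x ∈ C) (hxe : x ∈ starExt S) : C ⊆ starExt S :=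
  fun y hy => mem_starExt_of_reflTransGen hxe
    (reflTransGen_starRel_mono (fun z hz => (Set.disjoint_left.1 hCS hz : z ∉ (S : Set (Site d)))) (hC x hx y hy))

/-- A `★`-connected set avoiding `S` that meets an interior component lies in it. [folklore] -/
theorem subset_starIntComp_of_starConn (hd : 2 ≤ d) {S : Finset (Site d)} {C : Set (Site d)} (hC : StarConn C)
    (hCS : Disjoint C (S : Set (Site d))) {x : Site d} (hx : x ∈ C) (hxi : x ∈ starInt S) :
    C ⊆ (starIntComp S x : Set (Site d)) :=
  fun y hy => mem_coe.2 ((mem_starIntComp hd hxi).2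
    (reflTransGen_starRel_mono (fun z hz => (Set.disjoint_left.1 hCS hz : z ∉ (S : Set (Site d)))) (hC x hx y hy)))

/-! ### Every component touches `S`; complements of components are `★`-connected (Exercise 7.11) -/

/-- From any point off a non-empty `S`, a chain inside `Sᶜ` leads to a point `★`-adjacent to `S`.
[cite: FriedliVelenik2017, §7.2.6, Exercise 7.11] -/
theorem exists_reflTransGen_adj_of_not_mem {S : Finset (Site d)} (hS : S.Nonempty) {x : Site d} (hx : x ∉ S) :
    ∃ y z, z ∈ S ∧ (zdStar d).Adj y z ∧ ReflTransGen (starRel (S : Set (Site d))ᶜ) x y := by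
  obtain ⟨s, hs⟩ := hS
  have hchain := reflTransGen_starRel_univ x s
  -- walk along the chain until the first point of `S`
  revert hx
  refine ReflTransGen.head_induction_on hchain (fun hx => absurd hs hx) ?_
  intro a c hac _ ih ha
  by_cases hc : c ∈ S
  · exact ⟨a, c, hc, hac.1, ReflTransGen.refl⟩
  · obtain ⟨y, z, hz, hyz, hcy⟩ := ih hc
    exact ⟨y, z, hz, hyz, ReflTransGen.head ⟨hac.1, ha, hc⟩ hcy⟩

/-- **Exercise 7.11 (Friedli–Velenik): the complement of an interior component of `Sᶜ` is
`★`-connected** when `S` is `★`-connected: every point of the complement is chained, avoiding the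
component, to `S`. [cite: FriedliVelenik2017, §7.2.6, Exercise 7.11] -/
theorem starConn_compl_starIntComp (hd : 2 ≤ d) {S : Finset (Site d)} (hS : StarConn (S : Set (Site d)))
    {x : Site d} (hx : x ∈ starInt S) : StarConn (starIntComp S x : Set (Site d))ᶜ := by
  set C : Set (Site d) := ↑(starIntComp S x) with hCdef
  have hSne : S.Nonempty := by
    by_contra h
    rw [not_nonempty_iff_eq_empty] at h
    have : x ∈ starExt S := by
      refine (mem_starExt_iff hd (by rw [h]; exact empty_subset _ : S ⊆ box d 0)).2 ⟨by rw [h]; exact notMem_empty x, ?_⟩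
      refine ⟨fun _ => (0 : ℤ) + 1, corner_mem_farSet (by omega) le_rfl, ?_⟩
      exact reflTransGen_starRel_mono (fun z _ => by rw [h]; exact fun h' => notMem_empty z h') (reflTransGen_starRel_univ _ _)
    exact ((mem_starInt hd).1 hx).2 this
  have hSC : (S : Set (Site d)) ⊆ Cᶜ := fun z hz hzC => ((mem_starInt hd).1 (starIntComp_subset S x hzC)).1 hz
  -- `Cᶜ` is closed under `Sᶜ`-steps
  have hclosed : ∀ a ∈ Cᶜ, ∀ b, starRel (S : Set (Site d))ᶜ a b → b ∈ Cᶜ := by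
    intro a ha b hab hb
    exact ha (mem_coe.2 (mem_starIntComp_of_starRel hd hx (mem_coe.1 hb) (starRel_symm hab)))
  -- every point of `Cᶜ` is chained in `Cᶜ` to a point of `S`
  have hreach : ∀ u ∈ Cᶜ, ∃ z ∈ S, ReflTransGen (starRel Cᶜ) u z := by
    intro u hu
    by_cases huS : u ∈ S
    · exact ⟨u, huS, ReflTransGen.refl⟩
    obtain ⟨y, z, hz, hyz, huy⟩ := exists_reflTransGen_adj_of_not_mem hSne huS
    have h1 : ReflTransGen (starRel Cᶜ) u y := reflTransGen_starRel_restrict hclosed hu huy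
    exact ⟨z, hz, h1.tail ⟨hyz, mem_of_reflTransGen_starRel h1 hu, hSC (mem_coe.2 hz)⟩⟩
  intro u hu v hv
  obtain ⟨z, hz, huz⟩ := hreach u hu
  obtain ⟨z', hz', hvz'⟩ := hreach v hv
  exact (huz.trans (reflTransGen_starRel_mono hSC (hS z (mem_coe.2 hz) z' (mem_coe.2 hz')))).trans
    (reflTransGen_starRel_symm hvz')

/-- **The hull of a `★`-connected finite set is `★`-connected**: every interior point is chained
inside the interior to a point `★`-adjacent to `S`. [cite: FriedliVelenik2017, §7.2.6, Exercise 7.11] -/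
theorem starConn_starHull (hd : 2 ≤ d) {S : Finset (Site d)} (hS : StarConn (S : Set (Site d))) :
    StarConn (starHull S) := by
  by_cases hSne : S = ∅
  · -- empty `S`: the hull is empty
    intro u hu
    exfalso
    refine hu ((mem_starExt_iff hd (by rw [hSne]; exact empty_subset _ : S ⊆ box d 0)).2
      ⟨by rw [hSne]; exact notMem_empty u, fun _ => (0 : ℤ) + 1, corner_mem_farSet (by omega) le_rfl, ?_⟩)
    exact reflTransGen_starRel_mono (fun z _ => by rw [hSne]; exact fun h' => notMem_empty z h') (reflTransGen_starRel_univ _ _)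
  have hSne' : S.Nonempty := nonempty_iff_ne_empty.2 hSne
  have hSH : (S : Set (Site d)) ⊆ starHull S := subset_starHull S
  have hclosed : ∀ a ∈ starHull S, ∀ b, starRel (S : Set (Site d))ᶜ a b → b ∈ starHull S := by
    intro a ha b hab hb
    exact ha (mem_starExt_of_reflTransGen hb (ReflTransGen.single (starRel_symm hab)))
  have hreach : ∀ u ∈ starHull S, ∃ z ∈ S, ReflTransGen (starRel (starHull S)) u z := by
    intro u hu
    by_cases huS : u ∈ S
    · exact ⟨u, huS, ReflTransGen.refl⟩
    obtain ⟨y, z, hz, hyz, huy⟩ := exists_reflTransGen_adj_of_not_mem hSne' huS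
    have h1 : ReflTransGen (starRel (starHull S)) u y := reflTransGen_starRel_restrict hclosed hu huy
    exact ⟨z, hz, h1.tail ⟨hyz, mem_of_reflTransGen_starRel h1 hu, hSH (mem_coe.2 hz)⟩⟩
  intro u hu v hv
  obtain ⟨z, hz, huz⟩ := hreach u hu
  obtain ⟨z', hz', hvz'⟩ := hreach v hv
  exact (huz.trans (reflTransGen_starRel_mono hSH (hS z (mem_coe.2 hz) z' (mem_coe.2 hz')))).trans
    (reflTransGen_starRel_symm hvz')

/-! ### Lemma 7.19 geometry: boundaries of the components are `★`-connected -/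

/-- **Friedli–Velenik Lemma 7.19, interior components**: for a `★`-connected finite `S` and an
interior component `A` of `Sᶜ`, both `∂^in_★ A` and `∂^ex_★ A` are `★`-connected.
[cite: FriedliVelenik2017, §7.2.6, Lemma 7.19 (with App. B.15, Lemma B.82)] -/
theorem starConn_boundaries_starIntComp (hd : 2 ≤ d) {S : Finset (Site d)} (hS : StarConn (S : Set (Site d)))
    {x : Site d} (hx : x ∈ starInt S) :
    StarConn (inBoundary (starIntComp S x) : Set (Site d)) ∧ StarConn (exBoundary (starIntComp S x) : Set (Site d)) :=
  ⟨starConn_inBoundary (starConn_starIntComp hd hx) (starConn_compl_starIntComp hd hS hx),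
    starConn_exBoundary (starConn_starIntComp hd hx) (starConn_compl_starIntComp hd hS hx)⟩

/-- **Friedli–Velenik Lemma 7.19, exterior component**: for a `★`-connected finite `S`, the sets
`∂^in_★ (ext) = ∂^ex_★ (hull)` and `∂^ex_★ (ext) = ∂^in_★ (hull)` are `★`-connected.
[cite: FriedliVelenik2017, §7.2.6, Lemma 7.19 (with App. B.15, Lemma B.82)] -/
theorem starConn_boundaries_starHull (hd : 2 ≤ d) {S : Finset (Site d)} (hS : StarConn (S : Set (Site d))) :
    StarConn (exBoundary (starHullFinset S) : Set (Site d)) ∧ StarConn (inBoundary (starHullFinset S) : Set (Site d)) := by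
  have h1 : StarConn (starHullFinset S : Set (Site d)) := by rw [coe_starHullFinset hd]; exact starConn_starHull hd hS
  have h2 : StarConn (starHullFinset S : Set (Site d))ᶜ := by
    rw [coe_starHullFinset hd, starHull, compl_compl]; exact starConn_starExt hd S
  exact ⟨starConn_exBoundary h1 h2, starConn_inBoundary h1 h2⟩

end Literature.Probability.LatticeModels

end
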